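import Summits.QuantumFields.BalabanUV.T4Continuum.Support.ScalarBlockPlateauRamp

/-!
# T⁴ programme, spine node NE2 (U1a), tier B support row B4.c (iii), supplier «B4c-SIGMA-PLATEAU», file 1b — THE PLATEAU TRIAL
# FUNCTION on the blocks of [B5] (1.6)/(1.20): `ψ_φ(n·y + j) = φ(y)·Π_ν r(j_ν)` with the capped ramp `r` of file 1a; `Q′ψ_φ = (S₁/n)^d·φ`
# with `S₁ = Σ_t r(t) ≥ n + 1 − m`, and the Dirichlet bound `nsq (∂_νψ_φ) ≤ n²·S₂^{d−1}·((2m+2)/m²)·nsq φ`, `S₂ = Σ_t r(t)² ≤ S₁`,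
# with the product structure KEPT

NE2 formalisation swarm `b2b-balaban-t4-ne2-formalise-*`, leaf 05 (gen 8), supplier item «B4c-SIGMA-PLATEAU» (the «σ₀ lever»: replace the
`36^{−d}` of `ScalarAveragedCompression.sigma0` — an artefact of the parabola bump of `ScalarBlockTrialFunction`, block weight `β₁ → 1/6` —
by a polynomial-in-`d` constant).  With the ramp `r = ScalarBlockPlateauRamp.ramp n m` of width `m` (`1 ≤ m ≤ n`), this file builds the trial
function `ψ_φ` and proves its three estimates by lattice bookkeeping only, re-using leaf-09's digit calculus (`ScalarBlockTrialFunction.digits`,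
`bpt_add_unitVec_of_lt/eq`) BY NAME.  The one point that matters: the Dirichlet energy is summed with the PRODUCT STRUCTURE of the weight
(`Fintype.prod_sum`), so that the `d − 1` transverse digits contribute `S₂ = Σ_t r(t)² ≤ S₁` and not `n`:

 * §2 the WEIGHT `plateauW n m j = Π_ν r(j_ν)` (`plateauW_update`), the ramp sums `S1 n m = Σ_t r(t)`, `S2 n m = Σ_t r(t)²` (`S1_S2_bounds`:
   `0 ≤ S₂ ≤ S₁ ≤ n`, `n + 1 − m ≤ S₁`), `sum_plateauW_eq` (`Σ_j W(j) = S₁^d`), the trial function **`trialP n m M φ`**, **`QsOp_trialP`**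
   (`Q′ψ_φ = (S₁/n)^d·φ`), **`nsq_PiS_trialP`** (`nsq (Π′ψ_φ) = n^d·((S₁/n)^d)²·nsq φ`), `re_trialP_dot` (`re⟨ψ_φ, Q′ᴴφ⟩ = (S₁/n)^d·nsq φ`);
 * §3 the product-sum identity `sum_mul_prod_erase` (`Σ_j g(j_ν)·Π_{μ≠ν} h(j_μ) = (Σ g)·(Σ h)^{d−1}`), the per-digit `cost` of `∂_ν` (interior
   steps `|φ(y)|²(r(t+1) − r(t))²`, the face jump `|φ(y+e_ν) − φ(y)|²/m²` since `r(0) = r(n−1) = 1/m`), the EXACT site formula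
   `nsq_site_sdiff_trialP` and block sum `sum_block_nsq_sdiff_trialP` (`Σ_j |∂_νψ_φ(n·y+j)|² = n²·(Σ_t c_y(t))·S₂^{d−1}`), `sum_cost_le`
   (`Σ_t c_y(t) ≤ |φ(y)|²·2(m−1)/m² + |φ(y+e_ν) − φ(y)|²/m²`), **`nsq_sdiff_trialP_le`** (`nsq (∂_νψ_φ) ≤ n²·S₂^{d−1}·((2m+2)/m²)·nsq φ`) and
   **`dirichlet_trialP_le`** (`Σ_ν nsq (∂_νψ_φ) ≤ d·n²·S₂^{d−1}·((2m+2)/m²)·nsq φ`).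

HONEST FRAMING (T4-DAG p. 1).  [folklore] lattice bookkeeping about the cell's typed `U = 1` objects; statements / constants OURS;
nothing printed is a hypothesis; leaf-09's files are imported BY NAME and not edited.  `U = 1`, FIXED FINITE torus, scalar layer; a
SUPPORT input of rows B4.b/B4.c (it changes no binder of ROOT B — only the SIZE of its explicit threshold), NOT B4, NOT [B9]
(3.23)–(3.26) as printed; NE2 NOT proved; spine 0/9 unchanged; NOT infinite volume / mass gap / Clay / summit progress.  HONEST
DEPENDENCY: continuum YM on T⁴ ⇐ BetaPertH ∧ nine spine estimates (0/9 proved); BetaPertH ⇐ (D1) ∧ (D4) ∧ CAP+tail; G-an2-4 gates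
asym, D1 and NE2/3/4.  ABSOLUTE RULE kept; zero sorries.
-/

noncomputable section

open scoped BigOperators ComplexConjugate ComplexOrder Matrix Matrix.Norms.L2Operator
open Finset

namespace Summit.QuantumFields.BalabanUV.T4Continuum.ScalarBlockPlateauFunction

open Literature.MathematicalPhysics.QuantumFieldTheory.Balaban1983to89.B5Prop11Plancherel
open Literature.MathematicalPhysics.QuantumFieldTheory.Balaban1983to89.B5Prop11Lower (nsq nsq_nonneg star_dotProduct_self)
open Literature.MathematicalPhysics.QuantumFieldTheory.Balaban1983to89.B5Action121 (sdiff sdiff_mulVec star_mulVec_dotProduct)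
open Literature.MathematicalPhysics.QuantumFieldTheory.Balaban1983to89.B5Block118 (bpt QsOp QsOp_mulVec)
open Literature.MathematicalPhysics.QuantumFieldTheory.Balaban1983to89.B5Blocks16 (blockOf blockOf_bpt)
open Literature.MathematicalPhysics.QuantumFieldTheory.Balaban1983to89.B5AverageCurlStokes (sum_blocks_real)
open Summit.QuantumFields.BalabanUV.T4Continuum.ScalarBlockPoincare
open Summit.QuantumFields.BalabanUV.T4Continuum.ScalarAveragedPropagator
open Summit.QuantumFields.BalabanUV.T4Continuum.ScalarBlockTrialFunction
open Summit.QuantumFields.BalabanUV.T4Continuum.ScalarBlockPlateauRamp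

variable {d : ℕ}

/-! ## §2 The plateau weight and the trial function -/

section Trial

variable (n m : ℕ) [NeZero n] (M : Fin d → ℕ) [hM : ∀ μ, NeZero (M μ)]

/-- the plateau weight `W(j) = Π_ν r(j_ν)`. [folklore] -/
def plateauW (j : Fin d → Fin n) : ℝ := ∏ ν, ramp n m (j ν)

omit [NeZero n] in
/-- splitting off one digit: `W(j[ν ↦ v]) = r(v)·Π_{μ≠ν} r(j_μ)` and `W(j) = r(j_ν)·Π_{μ≠ν} r(j_μ)`. [folklore] -/
theorem plateauW_update (j : Fin d → Fin n) (ν : Fin d) (v : Fin n) :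
    plateauW n m (Function.update j ν v) = ramp n m v * ∏ μ ∈ Finset.univ.erase ν, ramp n m (j μ) ∧
    plateauW n m j = ramp n m (j ν) * ∏ μ ∈ Finset.univ.erase ν, ramp n m (j μ) := by
  constructor
  · unfold plateauW
    rw [← Finset.mul_prod_erase Finset.univ _ (Finset.mem_univ ν), Function.update_self]
    congr 1
    exact Finset.prod_congr rfl fun μ hμ => by rw [Function.update_of_ne (Finset.ne_of_mem_erase hμ)]
  · unfold plateauW
    rw [← Finset.mul_prod_erase Finset.univ _ (Finset.mem_univ ν)]

/-- the ramp sums `S₁ = Σ_t r(t)` and `S₂ = Σ_t r(t)²`. [folklore] -/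
def S1 (n m : ℕ) : ℝ := ∑ t : Fin n, ramp n m t

/-- `S₂ = Σ_t r(t)²`. [folklore] -/
def S2 (n m : ℕ) : ℝ := ∑ t : Fin n, ramp n m t ^ 2

omit [NeZero n] in
/-- `0 ≤ S₂ ≤ S₁ ≤ n` and `n + 1 − m ≤ S₁` (`1 ≤ m`). [folklore] -/
theorem S1_S2_bounds (hm : 1 ≤ m) : 0 ≤ S2 n m ∧ S2 n m ≤ S1 n m ∧ S1 n m ≤ n ∧ (n : ℝ) + 1 - m ≤ S1 n m := by
  refine ⟨Finset.sum_nonneg fun t _ => sq_nonneg _, sum_ramp_sq_le, ?_, sum_ramp_ge hm⟩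
  calc S1 n m ≤ ∑ _t : Fin n, (1 : ℝ) := Finset.sum_le_sum fun t _ => (ramp_mem (m := m) (t : ℕ) t.is_lt).2
    _ = n := by simp

omit [NeZero n] in
/-- `Σ_j W(j) = S₁^d`. [folklore] -/
theorem sum_plateauW_eq : ∑ j : Fin d → Fin n, plateauW n m j = (S1 n m) ^ d := by
  unfold plateauW S1
  rw [← Fintype.prod_sum (fun (_ν : Fin d) (t : Fin n) => ramp n m t), Finset.prod_const, Finset.card_univ, Fintype.card_fin]

/-- **the plateau trial function** `ψ_φ(x) = φ(block x)·W(digits x)`. [folklore] -/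
def trialP (φ : Tor M → ℂ) : Tor (fine n M) → ℂ := fun x => φ (blockOf n M x) * ((plateauW n m (digits n M x) : ℝ) : ℂ)

/-- `ψ_φ(n·y + j) = φ(y)·W(j)`. [folklore] -/
theorem trialP_bpt (φ : Tor M → ℂ) (y : Tor M) (j : Fin d → Fin n) :
    trialP n m M φ (bpt n M y j) = φ y * ((plateauW n m j : ℝ) : ℂ) := by
  rw [trialP, blockOf_bpt, digits_bpt]

/-- **`Q′ψ_φ = (S₁/n)^d·φ`**. [folklore] -/
theorem QsOp_trialP (φ : Tor M → ℂ) : QsOp n M *ᵥ trialP n m M φ = ((((S1 n m) / n) ^ d : ℝ) : ℂ) • φ := by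
  have hn' : (n : ℂ) ≠ 0 := by exact_mod_cast NeZero.ne n
  funext y
  rw [QsOp_mulVec, Pi.smul_apply, smul_eq_mul]
  simp only [trialP_bpt]
  rw [← Finset.mul_sum, ← Complex.ofReal_sum, sum_plateauW_eq n m, div_pow]
  push_cast
  field_simp

/-- hence `nsq (Π′ψ_φ) = n^d·(S₁/n)^{2d}·nsq φ`. [folklore] -/
theorem nsq_PiS_trialP (φ : Tor M → ℂ) :
    nsq (PiS n M *ᵥ trialP n m M φ) = (n : ℝ) ^ d * (((S1 n m) / n) ^ d) ^ 2 * nsq φ := by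
  rw [nsq_PiS_mulVec_eq, QsOp_trialP, nsq_smul, Complex.norm_real, Real.norm_eq_abs, sq_abs, mul_assoc]

/-- `re⟨ψ_φ, Q′ᴴφ⟩ = (S₁/n)^d·nsq φ`. [folklore] -/
theorem re_trialP_dot (φ : Tor M → ℂ) :
    (star (trialP n m M φ) ⬝ᵥ ((QsOp n M)ᴴ *ᵥ φ)).re = ((S1 n m) / n) ^ d * nsq φ := by
  rw [← star_mulVec_dotProduct, QsOp_trialP,
    star_smul, smul_dotProduct, star_dotProduct_self, smul_eq_mul, Complex.star_def, Complex.conj_ofReal, ← Complex.ofReal_mul,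
    Complex.ofReal_re]

end Trial

/-! ## §3 The Dirichlet energy of the plateau trial function, with the product structure kept -/

section Dirichlet

variable (n m : ℕ) [NeZero n] (M : Fin d → ℕ) [hM : ∀ μ, NeZero (M μ)]

omit [NeZero n] in
/-- the product-sum identity `Σ_j g(j_ν)·Π_{μ≠ν} h(j_μ) = (Σ_t g(t))·(Σ_t h(t))^{d−1}`. [folklore] -/
theorem sum_mul_prod_erase (g h : Fin n → ℝ) (ν : Fin d) :
    ∑ j : Fin d → Fin n, g (j ν) * ∏ μ ∈ Finset.univ.erase ν, h (j μ) = (∑ t, g t) * (∑ t, h t) ^ (d - 1) := by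
  have key : ∀ j : Fin d → Fin n, g (j ν) * ∏ μ ∈ Finset.univ.erase ν, h (j μ)
      = ∏ μ, (if μ = ν then g (j μ) else h (j μ)) := by
    intro j
    rw [← Finset.mul_prod_erase Finset.univ _ (Finset.mem_univ ν), if_pos rfl]
    congr 1
    exact Finset.prod_congr rfl fun μ hμ => by rw [if_neg (Finset.ne_of_mem_erase hμ)]
  simp_rw [key]
  rw [← Fintype.prod_sum (fun (μ : Fin d) (t : Fin n) => if μ = ν then g t else h t),
    ← Finset.mul_prod_erase Finset.univ _ (Finset.mem_univ ν)]
  simp only [if_true]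
  congr 1
  have e2 : ∏ μ ∈ Finset.univ.erase ν, (∑ t : Fin n, if μ = ν then g t else h t) = ∏ _μ ∈ Finset.univ.erase ν, ∑ t : Fin n, h t :=
    Finset.prod_congr rfl fun μ hμ => by simp only [if_neg (Finset.ne_of_mem_erase hμ)]
  rw [e2, Finset.prod_const, Finset.card_erase_of_mem (Finset.mem_univ ν), Finset.card_univ, Fintype.card_fin]

/-- the per-digit cost of `∂_ν` at block `y`: interior steps `|φ(y)|²(r(t+1) − r(t))²`, the face jump `|φ(y+e_ν) − φ(y)|²/m²`. [folklore] -/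
def cost (φ : Tor M → ℂ) (ν : Fin d) (y : Tor M) (t : Fin n) : ℝ :=
  if (t : ℕ) + 1 < n then ‖φ y‖ ^ 2 * (ramp n m ((t : ℕ) + 1) - ramp n m t) ^ 2
  else ‖φ (y + unitVec M ν) - φ y‖ ^ 2 / (m : ℝ) ^ 2

/-- THE EXACT SITE FORMULA: `|∂_νψ_φ(n·y + j)|² = n²·c_y(j_ν)·(Π_{μ≠ν} r(j_μ))²`. [folklore] -/
theorem nsq_site_sdiff_trialP (hm : 1 ≤ m) (φ : Tor M → ℂ) (ν : Fin d) (y : Tor M) (j : Fin d → Fin n) :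
    ‖(sdiff (fine n M) (n : ℂ) ν *ᵥ trialP n m M φ) (bpt n M y j)‖ ^ 2
      = (n : ℝ) ^ 2 * cost n m M φ ν y (j ν) * (∏ μ ∈ Finset.univ.erase ν, ramp n m (j μ)) ^ 2 := by
  have hn1 : 1 ≤ n := Nat.pos_of_ne_zero (NeZero.ne n)
  set R : ℝ := ∏ μ ∈ Finset.univ.erase ν, ramp n m (j μ) with hR
  have hW : plateauW n m j = ramp n m (j ν) * R := (plateauW_update n m j ν 0).2
  rw [sdiff_mulVec]
  by_cases h : (j ν : ℕ) + 1 < n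
  · -- inside the block
    have hW' : plateauW n m (Function.update j ν ⟨(j ν : ℕ) + 1, h⟩) = ramp n m ((j ν : ℕ) + 1) * R :=
      (plateauW_update n m j ν _).1
    rw [bpt_add_unitVec_of_lt n M y j ν h, trialP_bpt, trialP_bpt, hW', hW, cost, if_pos h]
    have e : (n : ℂ) * (φ y * (((ramp n m ((j ν : ℕ) + 1) * R : ℝ)) : ℂ) - φ y * (((ramp n m (j ν) * R : ℝ)) : ℂ))
        = φ y * ((((n : ℝ) * (ramp n m ((j ν : ℕ) + 1) - ramp n m (j ν)) * R : ℝ)) : ℂ) := by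
      push_cast; ring
    rw [e, norm_mul, Complex.norm_real, Real.norm_eq_abs, mul_pow, sq_abs]
    ring
  · -- across a face
    have heq : (j ν : ℕ) + 1 = n := by have := (j ν).is_lt; omega
    have hW' : plateauW n m (Function.update j ν 0) = ramp n m ((0 : Fin n) : ℕ) * R := (plateauW_update n m j ν 0).1
    have hf := ramp_face (m := m) hm hn1 (j ν) heq
    rw [bpt_add_unitVec_of_eq n M y j ν heq, trialP_bpt, trialP_bpt, hW', hW, Fin.val_zero, hf.1, hf.2, cost, if_neg h]
    have e : (n : ℂ) * (φ (y + unitVec M ν) * (((1 / (m : ℝ) * R : ℝ)) : ℂ) - φ y * (((1 / (m : ℝ) * R : ℝ)) : ℂ))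
        = (φ (y + unitVec M ν) - φ y) * ((((n : ℝ) / m * R : ℝ)) : ℂ) := by
      push_cast; ring
    rw [e, norm_mul, Complex.norm_real, Real.norm_eq_abs, mul_pow, sq_abs]
    have hm0 : (m : ℝ) ≠ 0 := by exact_mod_cast (by omega : m ≠ 0)
    field_simp

/-- the BLOCK SUM: `Σ_j |∂_νψ_φ(n·y + j)|² = n²·(Σ_t c_y(t))·S₂^{d−1}`. [folklore] -/
theorem sum_block_nsq_sdiff_trialP (hm : 1 ≤ m) (φ : Tor M → ℂ) (ν : Fin d) (y : Tor M) :
    ∑ j : Fin d → Fin n, ‖(sdiff (fine n M) (n : ℂ) ν *ᵥ trialP n m M φ) (bpt n M y j)‖ ^ 2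
      = (n : ℝ) ^ 2 * ((∑ t : Fin n, cost n m M φ ν y t) * (S2 n m) ^ (d - 1)) := by
  simp_rw [nsq_site_sdiff_trialP n m M hm φ ν y]
  rw [S2, ← sum_mul_prod_erase n (cost n m M φ ν y) (fun t => ramp n m t ^ 2) ν, Finset.mul_sum]
  refine Finset.sum_congr rfl fun j _ => ?_
  rw [Finset.prod_pow]
  ring

omit [NeZero n] hM in
/-- the digit costs of one block: `Σ_t c_y(t) ≤ |φ(y)|²·A + |φ(y+e_ν) − φ(y)|²/m²`, `A ≤ 2(m−1)/m²`. [folklore] -/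
theorem sum_cost_le (hm : 1 ≤ m) (φ : Tor M → ℂ) (ν : Fin d) (y : Tor M) :
    ∑ t : Fin n, cost n m M φ ν y t ≤ ‖φ y‖ ^ 2 * (2 * ((m : ℝ) - 1) / (m : ℝ) ^ 2) + ‖φ (y + unitVec M ν) - φ y‖ ^ 2 / (m : ℝ) ^ 2 := by
  have hsplit : ∀ t : Fin n, cost n m M φ ν y t
      = ‖φ y‖ ^ 2 * (if (t : ℕ) + 1 < n then (ramp n m ((t : ℕ) + 1) - ramp n m t) ^ 2 else 0)
        + ‖φ (y + unitVec M ν) - φ y‖ ^ 2 / (m : ℝ) ^ 2 * (if (t : ℕ) + 1 < n then (0 : ℝ) else 1) := by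
    intro t
    unfold cost
    split_ifs <;> simp
  simp_rw [hsplit]
  rw [Finset.sum_add_distrib, ← Finset.mul_sum, ← Finset.mul_sum]
  have h1 := sum_rampStep_sq_le (n := n) hm
  -- the face indicator is supported on the single digit `t = n − 1`
  have h2 : ∑ t : Fin n, (if (t : ℕ) + 1 < n then (0 : ℝ) else 1) ≤ 1 := by
    have e : ∀ t : Fin n, (if (t : ℕ) + 1 < n then (0 : ℝ) else 1) = if ¬((t : ℕ) + 1 < n) then 1 else 0 := by
      intro t; split_ifs <;> simp_all
    simp_rw [e]
    rw [Finset.sum_boole]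
    have hc : (Finset.univ.filter fun t : Fin n => ¬((t : ℕ) + 1 < n)).card ≤ 1 := by
      refine Finset.card_le_one.mpr fun a ha b hb => ?_
      simp only [Finset.mem_filter, Finset.mem_univ, true_and] at ha hb
      exact Fin.ext (by omega)
    exact_mod_cast hc
  have hA : 0 ≤ ‖φ y‖ ^ 2 := sq_nonneg _
  have hB : 0 ≤ ‖φ (y + unitVec M ν) - φ y‖ ^ 2 / (m : ℝ) ^ 2 := by positivity
  calc _ ≤ ‖φ y‖ ^ 2 * (2 * ((m : ℝ) - 1) / (m : ℝ) ^ 2) + ‖φ (y + unitVec M ν) - φ y‖ ^ 2 / (m : ℝ) ^ 2 * 1 := by gcongr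
    _ = _ := by ring

/-- **`nsq (∂_νψ_φ) ≤ n²·S₂^{d−1}·((2m+2)/m²)·nsq φ`**. [folklore] -/
theorem nsq_sdiff_trialP_le (hm : 1 ≤ m) (φ : Tor M → ℂ) (ν : Fin d) :
    nsq (sdiff (fine n M) (n : ℂ) ν *ᵥ trialP n m M φ)
      ≤ (n : ℝ) ^ 2 * (S2 n m) ^ (d - 1) * ((2 * (m : ℝ) + 2) / (m : ℝ) ^ 2) * nsq φ := by
  have hS2 : 0 ≤ (S2 n m) ^ (d - 1) := pow_nonneg (S1_S2_bounds n m hm).1 _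
  have hshift : ∑ y : Tor M, ‖φ (y + unitVec M ν)‖ ^ 2 = nsq φ :=
    Fintype.sum_equiv (Equiv.addRight (unitVec M ν)) _ _ fun y => rfl
  have hdiff : ∑ y : Tor M, ‖φ (y + unitVec M ν) - φ y‖ ^ 2 ≤ 4 * nsq φ := by
    calc ∑ y : Tor M, ‖φ (y + unitVec M ν) - φ y‖ ^ 2 ≤ ∑ y : Tor M, (2 * ‖φ (y + unitVec M ν)‖ ^ 2 + 2 * ‖φ y‖ ^ 2) := by
          refine Finset.sum_le_sum fun y _ => ?_
          have h := norm_sub_le (φ (y + unitVec M ν)) (φ y)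
          have h2 := pow_le_pow_left₀ (norm_nonneg _) h 2
          nlinarith [h2, sq_nonneg (‖φ (y + unitVec M ν)‖ - ‖φ y‖)]
      _ = 4 * nsq φ := by
          rw [Finset.sum_add_distrib, ← Finset.mul_sum, ← Finset.mul_sum, hshift]; unfold nsq; ring
  unfold nsq
  rw [sum_blocks_real n M (fun x => ‖(sdiff (fine n M) (n : ℂ) ν *ᵥ trialP n m M φ) x‖ ^ 2)]
  simp_rw [sum_block_nsq_sdiff_trialP n m M hm φ ν]
  rw [← Finset.mul_sum]
  calc (n : ℝ) ^ 2 * ∑ y : Tor M, (∑ t : Fin n, cost n m M φ ν y t) * S2 n m ^ (d - 1)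
      ≤ (n : ℝ) ^ 2 * ∑ y : Tor M, (‖φ y‖ ^ 2 * (2 * ((m : ℝ) - 1) / (m : ℝ) ^ 2)
          + ‖φ (y + unitVec M ν) - φ y‖ ^ 2 / (m : ℝ) ^ 2) * S2 n m ^ (d - 1) := by
        gcongr with y
        exact sum_cost_le n m M hm φ ν y
    _ = (n : ℝ) ^ 2 * S2 n m ^ (d - 1) * ((2 * ((m : ℝ) - 1) / (m : ℝ) ^ 2) * (∑ y : Tor M, ‖φ y‖ ^ 2)
          + (∑ y : Tor M, ‖φ (y + unitVec M ν) - φ y‖ ^ 2) / (m : ℝ) ^ 2) := by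
        rw [← Finset.sum_mul, Finset.sum_add_distrib, ← Finset.sum_mul, ← Finset.sum_div]; ring
    _ ≤ (n : ℝ) ^ 2 * S2 n m ^ (d - 1) * ((2 * ((m : ℝ) - 1) / (m : ℝ) ^ 2) * (∑ y : Tor M, ‖φ y‖ ^ 2)
          + (4 * ∑ y : Tor M, ‖φ y‖ ^ 2) / (m : ℝ) ^ 2) := by
        have h4 : (∑ y : Tor M, ‖φ (y + unitVec M ν) - φ y‖ ^ 2) ≤ 4 * ∑ y : Tor M, ‖φ y‖ ^ 2 := hdiff
        gcongr
    _ = (n : ℝ) ^ 2 * S2 n m ^ (d - 1) * ((2 * (m : ℝ) + 2) / (m : ℝ) ^ 2) * ∑ y : Tor M, ‖φ y‖ ^ 2 := by ring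

/-- **`Σ_ν nsq (∂_νψ_φ) ≤ d·n²·S₂^{d−1}·((2m+2)/m²)·nsq φ`**. [folklore] -/
theorem dirichlet_trialP_le (hm : 1 ≤ m) (φ : Tor M → ℂ) :
    dirichlet n M (trialP n m M φ) ≤ d * ((n : ℝ) ^ 2 * (S2 n m) ^ (d - 1) * ((2 * (m : ℝ) + 2) / (m : ℝ) ^ 2) * nsq φ) := by
  calc dirichlet n M (trialP n m M φ) = ∑ ν : Fin d, nsq (sdiff (fine n M) (n : ℂ) ν *ᵥ trialP n m M φ) := rfl
    _ ≤ ∑ _ν : Fin d, (n : ℝ) ^ 2 * (S2 n m) ^ (d - 1) * ((2 * (m : ℝ) + 2) / (m : ℝ) ^ 2) * nsq φ :=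
        Finset.sum_le_sum fun ν _ => nsq_sdiff_trialP_le n m M hm φ ν
    _ = _ := by rw [Finset.sum_const, Finset.card_univ, Fintype.card_fin, nsmul_eq_mul]

end Dirichlet


end Summit.QuantumFields.BalabanUV.T4Continuum.ScalarBlockPlateauFunction

end
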